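import Summits.RiemannHypothesis.RiemannHypothesis.Theorems.IntegerScrewScrewPolyFloorStructure
import Summits.RiemannHypothesis.RiemannHypothesis.Theorems.IntegerScrewScrewPolyFloorSplit
import Summits.RiemannHypothesis.RiemannHypothesis.Theorems.IntegerScrewDiscreteLandau
import Summits.RiemannHypothesis.RiemannHypothesis.Theorems.IntegerScrewScrewUpperSlack
import Summits.RiemannHypothesis.RiemannHypothesis.Theorems.ScrewPolyFloor.Negative.ScrewPolyFloorIndexFromOne
import Summits.RiemannHypothesis.RiemannHypothesis.Theorems.ScrewPolyFloor.Negative.ScrewPolyFloorSignOfC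
import Summits.RiemannHypothesis.RiemannHypothesis.Theorems.ScrewPolyFloor.Negative.ScrewPolyFloorDiagonalInfimum
import Literature.NumberTheory.LFunctions.ZetaScrewProofs
import HarnessLib

/-!
# Disproof of `ScrewPolyFloor` (stmt-RiemannHypothesis-15757) — findings

Refuter `cdisprove`, cycle 1 (2026-08-17; rev 3).  Crux (route IntegerScrew, rank 2):
`ScrewPolyFloor : ∃ A c : ℝ, 0 < c ∧ ∀ M x, c·M^{-A}·Σ_{2≤m≤M} x_m² ≤ Σ_{2≤m,m'≤M} G(log m, log m') x_m x_m'`,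
`G = zetaScrewKernel`, `G(t,u) = Ψ(t)+Ψ(u)−Ψ(t−u)`, `Ψ = zetaScrew` (Suzuki2023 (1.1)).

## 0. Verdict — NO UNCONDITIONAL KILL EXISTS: the crux is kernel-checked `↔ RiemannHypothesis`
`IntegerScrew.screwPolyFloor_iff_riemannHypothesis` (Theorems/IntegerScrewScrewPolyFloorStructure.lean,
p155064), `IntegerScrewSplit.screwPolyFloor_iff_rh_and_floor` (…Split.lean, p156840), floor half
`floorOfRH_proof` (p154030).  Hence `¬ ScrewPolyFloor ↔ ¬ RH` (§0 below): a refutation of the crux is a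
disproof of RH; a certified `λ_min(S_M) < 0` would be an RH counterexample (route kill k2; RH is
verified to 3·10¹², and an off-line zero `½+η+iγ₀` is first visible at `M ≳ γ₀^{2/η}`).  What a
disprover CAN do is map which parts of the statement carry the content — all of it is landed or
filed below as `Negative/` lemmas — and which natural strengthenings are false.

## 1. Load-bearing analysis (a) — hypotheses of the crux
* H1 `2 ≤ m` (index set `Icc 2 M`): DROPPED ⇒ FALSE.  `e₁` is an exact kernel vector (`G(0,·) = 0`).
  LANDED: Theorems/ScrewPolyFloor/Negative/ScrewPolyFloorIndexFromOne.lean (p158547 ACCEPTED):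
  `Negative.screwPolyFloor_false_from_one`, `fromOne_floor_fails_at_every_level`, `screwForm_fromOne_eq`
  (re-exported below as `false_from_one`).
* H2 `0 < c`: DROPPED ⇒ TRIVIALLY TRUE, unconditionally (`A = −2`, `c = −3K` from the RH-free growth
  bound `|Ψ(t)| ≤ K e^{|t|}`, Suzuki2023 Thm 1.1(3)).  ALL content is the sign.
  LANDED: …/Negative/ScrewPolyFloorSignOfC.lean (p161312 ACCEPTED): `Negative.screwPolyFloor_anySign_holds`,
  `abs_zetaScrewKernel_log_le` (entries `≤ 3KM`), `abs_screwForm_le` (`|x·S_M·x| ≤ 3KM²Σx²`) (alias `anySign_holds`).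
* H3 `∃ A` (the exponent is free): PRESCRIBED `A < 1` ⇒ FALSE unconditionally (`not_floor_of_lt_one`,
  from the landed RH-free `screwUpperSlack_proof`); `A = 0` (uniformly positive definite) FALSE;
  `A < 0` FALSE.  Every witness has `A ≥ 1` (`one_le_of_floor`).  LANDED: …/Negative/ScrewPolyFloorExponent.lean
  (p161268 ACCEPTED): `Negative.floor_le_upperSlack`, `one_le_of_floor`, `not_floor_of_lt_one`, `not_uniformFloor`,
  `not_floor_of_neg`, `screwPolyFloor_exponent_ge_one` (inline copies below).
* H3' the DIAGONAL consequence (the only thing `closes` uses: `c·m^{-A} ≤ 2Ψ(log m)`): its natural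
  strengthening "uniform positive diagonal margin `Ψ(log m) ≥ c > 0`" is FALSE unconditionally —
  `liminf_m Ψ(log m) ≤ 0` (RH branch: Dirichlet simultaneous approximation on the zero ordinates +
  node rounding; ¬RH branch: Landau engine).  LANDED: …/Negative/ScrewPolyFloorDiagonalInfimum.lean
  (p161936 ACCEPTED): `Negative.exists_zetaScrew_log_lt`, `zetaScrew_log_not_uniformly_positive`,
  `screwPolyFloor_diag_not_uniform`, `dirichlet_simultaneous` (alias `diag_not_uniformly_positive` below,
  formerly near-miss 1).
* H4 quantifier order / additive weakenings: NOTHING weaker along the `M`-axis escapes RH (§1' below,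
  sorry-free): `(∀ M x, 0 ≤ form) ↔ RH`, `(∀ M ≥ 2, ∃ c_M > 0, floor) ↔ RH`, and even the ADDITIVE
  slack `(∃ K, ∀ M x, −K·Σx² ≤ form) ↔ RH` (diagonal + `nodeSlack` + `robustLandau`).  Against that,
  `−K·M²·Σx² ≤ form` is trivial (H2).  So the triviality threshold of "`form ≥ −K·M^a·Σx²`" lies in
  `0 < a ≤ 3/2` (a = 3/2 is also trivial from `|Ψ(t)| ≤ K e^{t/2}`; `a < η` fails under an off-line
  zero of offset `η` — not formalised).
* H5 the sampling set `log ℕ`: replacing `log m` by other nodes is not a droppable hypothesis; at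
  integer nodes `t = m` PSD is still RH-implied (Thm 1.2) but no longer known to imply RH (aliasing of
  `γ mod 2π`); no refutation available.  Junk values: `M = 0, 1` give `0 ≤ 0`; `(0:ℝ)^(-A)` harmless.

## 2. Tightness (b)
* `floor_le_upperSlack`: any floor pair has `c·M^{-A} ≤ 16 (log M)³/M` (`M ≥ 4`), so `A ≥ 1`.
  Sharper, not landed: the same two-point vector gives `λ_min(S_M) ≤ Ψ(log(M/(M−1))) ≤ 8(1+log M)/M`
  (`IntegerScrew.zetaScrew_le_of_le_half`), and `Ψ(v) ~ (v/2) log(1/v)` as `v → 0⁺`.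
* `floor_constant_at_two`: any floor pair has `c·2^{-A} ≤ 2Ψ(log 2)` (`≈ 0.127`); numerically the
  binding levels for `A = 1` are `M = 3` (`λ_min·M ≈ 0.12`) and `M = 8` (`0.196`), while
  `λ_min(S_M)·M → 0.2519` flat for `M ≤ 4000` (route evidence NUMERICS-gen1.md, kit j024838/j025404):
  the observed law sits exactly at the boundary `A = 1` allowed by §2.

## 3. Natural strengthenings refuted (c)
prescribed `A < 1`; uniform floor; growing floor; index from `1` — all unconditional, all landed/filed.
NOT refutable here: `A = 1` with explicit `c` (needs certified numerics of `Ψ(log 2), Ψ(log 3), Ψ(log 3/2)`).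

## 4. Targets (d)
none — `payload.stuck_stubs = []`; the only registered stub `stub_targetPSD` is the route target
`IntegerScrewPSD`, itself `↔ RH` (`IntegerScrew.integerScrewPSD_iff_riemannHypothesis`): un-killable
short of `¬RH`.  Line `Sketch` is dead at `HeadSign ⟺ RH` (Lines/Sketch.dead.md).

## 5. Near-misses (e) — stated with `sorry`, obstruction in the docstring
* (resolved at rev 2) `diag_not_uniformly_positive` is now a THEOREM (Negative/ScrewPolyFloorDiagonalInfimum).
* `logFree_upperSlack`: `λ_min(S_M) ≤ C/M` (numerics `0.25/M`, delocalised ζ-like bottom eigenvector).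
  NEW OBSTRUCTION (rev 2, on paper): no vector supported in a window of ratio `< 2` (prime-free wall)
  can do better than `Θ(log M / M)`: for zero-sum `x` on a block near `N`,
  `x·S_M·x = (1/2N)[(log N + 2c₁)·A(x) + B(x)] + o(‖x‖²/N)` with `A(x) = −Σ x_j x_j' |j−j'| = 2Σ_k s_k²`
  (`s_k` partial sums) and `‖x‖² ≤ 4Σ s_k²`, so `A(x) ≥ ‖x‖²/2` and the `log N` term alone contributes
  `≥ (log N)/(4N)·‖x‖²`; the log can only be removed by vectors that see the primes (ratios `≥ 2`,
  the Helson form) — consistent with the ζ-like delocalised numerical bottom eigenvector (kit j025404).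

WHY IT RESISTS: `ScrewPolyFloor = RH ∧ (RH → floor)` and the second conjunct is a theorem
(`floorOfRH_proof`); every mutation that keeps a one-sided bound on `Ψ` along `log ℕ` is RH by the
landed Landau engine (`robustLandau`), every mutation that loses it is trivial or false (this file).
PHASE DIAGRAM of "`∃ c > 0, ∀ M x, c·f(M)·Σx² ≤ x·S_M·x`": `f ≫ (log M)³/M` i.o. ⇒ FALSE (landed);
`f = M^{-A}`, `A < 1` ⇒ FALSE; `1 ≤ A` ⇒ implies RH, and RH ⇒ it for `A ≥ A₀` (`floorOfRH_proof`);
`A = 1` ⇐ RH is OPEN (pair-correlation strength); additive versions `−K` ⇔ RH, `−K M²` trivial.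
-/

-- `Summit.RiemannHypothesis.RiemannHypothesis.…` duplicates `RiemannHypothesis` BY DESIGN (D-0017).
set_option linter.dupNamespace false

noncomputable section

namespace Summit.RiemannHypothesis.RiemannHypothesis.Cruxes.ScrewPolyFloor.Disproof

open Literature.NumberTheory.LFunctions Filter Asymptotics
open Summit.RiemannHypothesis.RiemannHypothesis.Theses.IntegerScrew
open Summit.RiemannHypothesis.RiemannHypothesis.Theorems
open scoped BigOperators Topology

/-! ## §0 The crux is RH: what a kill would mean -/

/-- `¬ ScrewPolyFloor ↔ ¬ RH` (from the landed `IntegerScrew.screwPolyFloor_iff_riemannHypothesis`). -/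
theorem not_screwPolyFloor_iff_not_rh : ¬ ScrewPolyFloor ↔ ¬ _root_.RiemannHypothesis :=
  not_congr IntegerScrew.screwPolyFloor_iff_riemannHypothesis

/-- The only road to a kill: an off-line nontrivial zero of `ζ` refutes the crux. -/
theorem screwPolyFloor_false_of_offLine_zero
    (h : ∃ s : ℂ, riemannZeta s = 0 ∧ (¬ ∃ n : ℕ, s = -2 * (n + 1)) ∧ s ≠ 1 ∧ s.re ≠ 1 / 2) :
    ¬ ScrewPolyFloor := by
  rw [not_screwPolyFloor_iff_not_rh]
  rintro hRH
  obtain ⟨s, hs, htriv, h1, hre⟩ := h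
  exact hre (hRH s hs htriv h1)

/-! ## §1 Load-bearing hypotheses -/

/-- The screw form of the indicator of `m ∈ Icc 2 M` is the diagonal entry `2Ψ(log m)`. -/
theorem form_indicator {M m : ℕ} (hm : m ∈ Finset.Icc 2 M) :
    ∑ a ∈ Finset.Icc 2 M, ∑ b ∈ Finset.Icc 2 M,
        zetaScrewKernel (Real.log a) (Real.log b) *
          ((if a = m then (1 : ℝ) else 0) * (if b = m then (1 : ℝ) else 0)) =
      2 * zetaScrew (Real.log m) := by
  classical
  rw [Finset.sum_eq_single m]
  · rw [Finset.sum_eq_single m]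
    · simp [zetaScrewKernel_self]
    · intro b _ hb
      simp [hb]
    · intro hnot
      exact absurd hm hnot
  · intro a _ ha
    apply Finset.sum_eq_zero
    intro b _
    simp [ha]
  · intro hnot
    exact absurd hm hnot

/-- The square-sum of the indicator of `m ∈ Icc 2 M` is `1`. -/
theorem sq_indicator {M m : ℕ} (hm : m ∈ Finset.Icc 2 M) :
    ∑ a ∈ Finset.Icc 2 M, (if a = m then (1 : ℝ) else 0) ^ 2 = 1 := by
  classical
  rw [Finset.sum_eq_single m (fun b _ hb => by simp [hb]) (fun hn => absurd hm hn)]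
  simp

/-- **H1 (`2 ≤ m`) is load-bearing**: the crux over `Icc 1 M` is false (`M = 1`, `x = 𝟙_1`:
`c ≤ 0`).  LANDED: `Cruxes.ScrewPolyFloor.Negative.screwPolyFloor_false_from_one` (p158547). -/
theorem false_from_one :
    ¬ (∃ A c : ℝ, 0 < c ∧ ∀ (M : ℕ) (x : ℕ → ℝ),
        c * (M : ℝ) ^ (-A) * ∑ m ∈ Finset.Icc 1 M, x m ^ 2 ≤
          ∑ m ∈ Finset.Icc 1 M, ∑ m' ∈ Finset.Icc 1 M,
            zetaScrewKernel (Real.log m) (Real.log m') * (x m * x m')) :=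
  Summit.RiemannHypothesis.Cruxes.ScrewPolyFloor.Negative.screwPolyFloor_false_from_one

/-- **H2 (`0 < c`) carries all the content**: with `0 < c` dropped the crux is an unconditional
theorem (`A = −2`, `c = −3K`).  LANDED: `Cruxes.ScrewPolyFloor.Negative.screwPolyFloor_anySign_holds`
(p161312), with the entry bound `abs_zetaScrewKernel_log_le` and the form bound `abs_screwForm_le`. -/
theorem anySign_holds :
    ∃ A c : ℝ, ∀ (M : ℕ) (x : ℕ → ℝ),
      c * (M : ℝ) ^ (-A) * ∑ m ∈ Finset.Icc 2 M, x m ^ 2 ≤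
        ∑ m ∈ Finset.Icc 2 M, ∑ m' ∈ Finset.Icc 2 M,
          zetaScrewKernel (Real.log m) (Real.log m') * (x m * x m') :=
  Summit.RiemannHypothesis.Cruxes.ScrewPolyFloor.Negative.screwPolyFloor_anySign_holds

/-- The triviality threshold made quantitative: `x·S_M·x ≥ −3K·M²·Σx²` unconditionally (from the
landed form bound), versus `x·S_M·x ≥ −K·Σx² ⇔ RH` (`additiveSlack_iff_rh` below). -/
theorem form_ge_neg_poly :
    ∃ K : ℝ, 0 ≤ K ∧ ∀ (M : ℕ) (x : ℕ → ℝ),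
      -(3 * K * (M : ℝ) ^ 2) * ∑ m ∈ Finset.Icc 2 M, x m ^ 2 ≤
        ∑ m ∈ Finset.Icc 2 M, ∑ m' ∈ Finset.Icc 2 M,
          zetaScrewKernel (Real.log m) (Real.log m') * (x m * x m') := by
  obtain ⟨K, hK0, hK⟩ := Summit.RiemannHypothesis.Cruxes.ScrewPolyFloor.Negative.exists_abs_zetaScrew_le_exp
  refine ⟨K, hK0, fun M x => ?_⟩
  have h := Summit.RiemannHypothesis.Cruxes.ScrewPolyFloor.Negative.abs_screwForm_le hK0 hK M x
  have h' := neg_abs_le (∑ m ∈ Finset.Icc 2 M, ∑ m' ∈ Finset.Icc 2 M,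
    zetaScrewKernel (Real.log m) (Real.log m') * (x m * x m'))
  linarith

/-- (Inline copy of the LANDED `Negative/ScrewPolyFloorExponent.lean`, p161268 ACCEPTED — kept inline so this
workfile elaborates before the farm has built that module.)  **Quantitative tightness.** Every floor pair `(A, c)` is dominated by the RH-free upper slack
of the tree (`screwUpperSlack_proof`): `c · M^{-A} ≤ C (log M)³ / M` for all `M ≥ M₀`
(with the tree's witness, `C = 16`, `M₀ = 4`).  No positivity of `c` needed. -/
theorem floor_le_upperSlack {A c : ℝ}
    (h : ∀ (M : ℕ) (x : ℕ → ℝ),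
      c * (M : ℝ) ^ (-A) * ∑ m ∈ Finset.Icc 2 M, x m ^ 2 ≤
        ∑ m ∈ Finset.Icc 2 M, ∑ m' ∈ Finset.Icc 2 M,
          zetaScrewKernel (Real.log m) (Real.log m') * (x m * x m')) :
    ∃ C : ℝ, ∃ M₀ : ℕ, ∀ M : ℕ, M₀ ≤ M →
      c * (M : ℝ) ^ (-A) ≤ C * Real.log M ^ 3 / M := by
  obtain ⟨C, M₀, hU⟩ := screwUpperSlack_proof
  refine ⟨C, M₀, fun M hM => ?_⟩
  obtain ⟨x, hpos, hle⟩ := hU M hM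
  exact le_of_mul_le_mul_right (le_trans (h M x) hle) hpos

/-- **The exponent of any polynomial floor is at least `1`.**  If `c > 0` and
`c · M^{-A} · Σ_{2 ≤ m ≤ M} x_m² ≤ x·S_M·x` for all `M, x`, then `1 ≤ A`: otherwise
`c · M^{1-A} ≤ C (log M)³` for all large `M`, contradicting `(log M)³ = o(M^{1-A})`. -/
theorem one_le_of_floor {A c : ℝ} (hc : 0 < c)
    (h : ∀ (M : ℕ) (x : ℕ → ℝ),
      c * (M : ℝ) ^ (-A) * ∑ m ∈ Finset.Icc 2 M, x m ^ 2 ≤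
        ∑ m ∈ Finset.Icc 2 M, ∑ m' ∈ Finset.Icc 2 M,
          zetaScrewKernel (Real.log m) (Real.log m') * (x m * x m')) :
    1 ≤ A := by
  by_contra hA
  rw [not_le] at hA
  obtain ⟨C, M₀, hb⟩ := floor_le_upperSlack h
  have hs : 0 < 1 - A := by linarith
  -- `(log x)^3 = o(x^{1-A})` along the reals, with the constant `c / (2 (|C| + 1))`
  have hlo := isLittleO_log_rpow_rpow_atTop ((3 : ℕ) : ℝ) hs
  simp only [Real.rpow_natCast] at hlo
  have hCpos : 0 < |C| + 1 := by positivity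
  have hε : 0 < c / 2 / (|C| + 1) := by positivity
  have hev : ∀ᶠ x : ℝ in atTop, (|C| + 1) * Real.log x ^ 3 ≤ c / 2 * x ^ (1 - A) := by
    filter_upwards [hlo.def hε, eventually_ge_atTop (1 : ℝ)] with x hx hx1
    have hlog : 0 ≤ Real.log x := Real.log_nonneg hx1
    rw [Real.norm_eq_abs, Real.norm_eq_abs, abs_of_nonneg (pow_nonneg hlog 3),
      abs_of_nonneg (Real.rpow_nonneg (by linarith) _)] at hx
    have e : (|C| + 1) * (c / 2 / (|C| + 1) * x ^ (1 - A)) = c / 2 * x ^ (1 - A) := by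
      field_simp
    calc (|C| + 1) * Real.log x ^ 3 ≤ (|C| + 1) * (c / 2 / (|C| + 1) * x ^ (1 - A)) :=
          mul_le_mul_of_nonneg_left hx hCpos.le
      _ = c / 2 * x ^ (1 - A) := e
  -- evaluate at a large natural number `M ≥ max M₀ 1`
  have hevN := (tendsto_natCast_atTop_atTop (R := ℝ)).eventually hev
  obtain ⟨M, hM1, hM2⟩ := (hevN.and (eventually_ge_atTop (max M₀ 1))).exists
  have hMM₀ : M₀ ≤ M := le_trans (le_max_left _ _) hM2
  have hM1' : 1 ≤ M := le_trans (le_max_right _ _) hM2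
  have hMpos : (0 : ℝ) < M := by exact_mod_cast hM1'
  have hbM := hb M hMM₀
  -- `c M^{-A} · M ≤ C (log M)^3 ≤ (|C|+1) (log M)^3 ≤ (c/2) M^{1-A}`
  have h1 : c * (M : ℝ) ^ (-A) * M ≤ C * Real.log M ^ 3 := (le_div_iff₀ hMpos).1 hbM
  have hlog3 : 0 ≤ Real.log (M : ℝ) ^ 3 :=
    pow_nonneg (Real.log_nonneg (by exact_mod_cast hM1')) 3
  have h2 : C * Real.log M ^ 3 ≤ (|C| + 1) * Real.log M ^ 3 :=
    mul_le_mul_of_nonneg_right (by linarith [le_abs_self C]) hlog3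
  have hpow : (M : ℝ) ^ (1 - A) = (M : ℝ) ^ (-A) * M := by
    rw [sub_eq_neg_add, Real.rpow_add hMpos, Real.rpow_one]
  have hpos : 0 < (M : ℝ) ^ (1 - A) := Real.rpow_pos_of_pos hMpos _
  have h3 : c * (M : ℝ) ^ (1 - A) ≤ c / 2 * (M : ℝ) ^ (1 - A) := by
    calc c * (M : ℝ) ^ (1 - A) = c * (M : ℝ) ^ (-A) * M := by rw [hpow, mul_assoc]
      _ ≤ C * Real.log M ^ 3 := h1
      _ ≤ (|C| + 1) * Real.log M ^ 3 := h2
      _ ≤ c / 2 * (M : ℝ) ^ (1 - A) := hM1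
  nlinarith

/-- **Natural strengthening refuted**: the crux with a PRESCRIBED exponent `A < 1`
(`∃ c > 0, floor at (A, c)`) is false, unconditionally. -/
theorem not_floor_of_lt_one {A : ℝ} (hA : A < 1) :
    ¬ (∃ c : ℝ, 0 < c ∧ ∀ (M : ℕ) (x : ℕ → ℝ),
        c * (M : ℝ) ^ (-A) * ∑ m ∈ Finset.Icc 2 M, x m ^ 2 ≤
          ∑ m ∈ Finset.Icc 2 M, ∑ m' ∈ Finset.Icc 2 M,
            zetaScrewKernel (Real.log m) (Real.log m') * (x m * x m')) :=
  fun ⟨_, hc, h⟩ => absurd (one_le_of_floor hc h) (not_le.2 hA)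

/-- **No uniform floor** (the case `A = 0`): the screw-kernel Gram matrices on the log-integers
are not uniformly positive definite — `λ_min(S_M) ≥ c > 0` for all `M` is false
(unconditionally; indeed `λ_min(S_M) ≤ Ψ(log(M/(M−1))) → 0`). -/
theorem not_uniformFloor :
    ¬ (∃ c : ℝ, 0 < c ∧ ∀ (M : ℕ) (x : ℕ → ℝ),
        c * ∑ m ∈ Finset.Icc 2 M, x m ^ 2 ≤
          ∑ m ∈ Finset.Icc 2 M, ∑ m' ∈ Finset.Icc 2 M,
            zetaScrewKernel (Real.log m) (Real.log m') * (x m * x m')) := by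
  rintro ⟨c, hc, h⟩
  refine not_floor_of_lt_one (A := 0) zero_lt_one ⟨c, hc, fun M x => ?_⟩
  simpa [Real.rpow_zero] using h M x

/-- **No growing floor either** (the case `A < 0`, e.g. `λ_min(S_M) ≥ c · M`): immediate from
`not_floor_of_lt_one`; recorded because the crux's `∃ A : ℝ` ranges over all reals. -/
theorem not_floor_of_neg {A : ℝ} (hA : A < 0) :
    ¬ (∃ c : ℝ, 0 < c ∧ ∀ (M : ℕ) (x : ℕ → ℝ),
        c * (M : ℝ) ^ (-A) * ∑ m ∈ Finset.Icc 2 M, x m ^ 2 ≤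
          ∑ m ∈ Finset.Icc 2 M, ∑ m' ∈ Finset.Icc 2 M,
            zetaScrewKernel (Real.log m) (Real.log m') * (x m * x m')) :=
  not_floor_of_lt_one (by linarith)

/-- The lemma read on the crux: **every witness pair of `ScrewPolyFloor` has exponent `A ≥ 1`**
(so the numerically observed `λ_min(S_M) · M ≈ 0.25` is at the boundary of what is possible,
and a proof of the crux — which is RH-equivalent, `IntegerScrew.screwPolyFloor_iff_riemannHypothesis`
— can only ever produce `A ≥ 1`). -/
theorem screwPolyFloor_exponent_ge_one (hF : ScrewPolyFloor) :
    ∃ A c : ℝ, 1 ≤ A ∧ 0 < c ∧ ∀ (M : ℕ) (x : ℕ → ℝ),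
      c * (M : ℝ) ^ (-A) * ∑ m ∈ Finset.Icc 2 M, x m ^ 2 ≤
        ∑ m ∈ Finset.Icc 2 M, ∑ m' ∈ Finset.Icc 2 M,
          zetaScrewKernel (Real.log m) (Real.log m') * (x m * x m') := by
  obtain ⟨A, c, hc, h⟩ := hF
  exact ⟨A, c, one_le_of_floor hc h, hc, h⟩


/-! ## §1' No weakening along the `M`-axis escapes RH -/

/-- Diagonal extraction from an ADDITIVE lower bound: if `−K·Σx² ≤ x·S_M·x` for all `M, x` then
`Ψ(log m) ≥ −|K|/2` for every `m ≥ 1`. -/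
theorem diag_of_additive {K : ℝ}
    (h : ∀ (M : ℕ) (x : ℕ → ℝ),
      -K * ∑ m ∈ Finset.Icc 2 M, x m ^ 2 ≤
        ∑ m ∈ Finset.Icc 2 M, ∑ m' ∈ Finset.Icc 2 M,
          zetaScrewKernel (Real.log m) (Real.log m') * (x m * x m')) :
    ∀ m : ℕ, 1 ≤ m → -(|K| / 2) ≤ zetaScrew (Real.log m) := by
  intro m hm
  rcases Nat.lt_or_ge m 2 with hlt | hge
  · have h1 : m = 1 := by omega
    subst h1
    simp only [Nat.cast_one, Real.log_one, zetaScrew_zero]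
    have : 0 ≤ |K| := abs_nonneg K
    linarith
  · classical
    have hmem : m ∈ Finset.Icc 2 m := Finset.mem_Icc.mpr ⟨hge, le_rfl⟩
    have h1 := h m (fun k => if k = m then 1 else 0)
    rw [form_indicator hmem, sq_indicator hmem] at h1
    have : -|K| ≤ -K := neg_le_neg (le_abs_self K)
    linarith

/-- **Bounded-below diagonal already gives RH** (Landau engine of the tree: `nodeSlack` +
`robustLandau` + `quasiRiemannHypothesis_one_half_iff_holds`, verbatim the tail of
`DiscreteLandau_proof` with `0` replaced by `−K`). -/
theorem rh_of_diag_bddBelow {K : ℝ} (hd : ∀ m : ℕ, 1 ≤ m → -K ≤ zetaScrew (Real.log m)) :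
    _root_.RiemannHypothesis := by
  obtain ⟨K₆, hK₆⟩ := IntegerScrewDiscreteLandau.nodeSlack
  have hbdd : ∀ t : ℝ, 0 ≤ t → -(K + K₆) ≤ zetaScrew t := by
    intro t ht
    have hfloor : 1 ≤ ⌊Real.exp t⌋₊ := (Nat.one_le_floor_iff _).2 (Real.one_le_exp ht)
    have hnode := hd _ hfloor
    have hint := hK₆ t ht
    linarith
  refine quasiRiemannHypothesis_one_half_iff_holds.1 fun s hs h1' h2' => ?_
  have hξ : riemannXi s = 0 := (riemannXi_eq_zero_iff_holds s).2 ⟨hs, by linarith, h2'⟩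
  have hw : 0 < (s - 1 / 2).re := by simp; linarith
  refine IntegerScrewDiscreteLandau.robustLandau (K + K₆) hbdd (s - 1 / 2) hw ?_
  rw [show (1 / 2 : ℂ) + (s - 1 / 2) = s by ring]
  exact hξ

/-- **The ADDITIVE-slack weakening of the crux is still RH**: `(∃ K, ∀ M x, −K·Σx² ≤ x·S_M·x) ↔ RH`.
(→: diagonal + Landau engine; ←: RH ⇒ the floor ⇒ the form is `≥ 0`.)  Contrast: `−K·M²·Σx² ≤ form`
is trivially true (`anySign_holds`). -/
theorem additiveSlack_iff_rh :
    (∃ K : ℝ, ∀ (M : ℕ) (x : ℕ → ℝ),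
      -K * ∑ m ∈ Finset.Icc 2 M, x m ^ 2 ≤
        ∑ m ∈ Finset.Icc 2 M, ∑ m' ∈ Finset.Icc 2 M,
          zetaScrewKernel (Real.log m) (Real.log m') * (x m * x m')) ↔
    _root_.RiemannHypothesis := by
  constructor
  · rintro ⟨K, h⟩
    exact rh_of_diag_bddBelow (diag_of_additive h)
  · intro hRH
    obtain ⟨A, c, hc, h⟩ := floorOfRH_proof hRH
    refine ⟨0, fun M x => ?_⟩
    have hsq : 0 ≤ ∑ m ∈ Finset.Icc 2 M, x m ^ 2 := Finset.sum_nonneg fun m _ => sq_nonneg _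
    have h0 : 0 ≤ c * (M : ℝ) ^ (-A) * ∑ m ∈ Finset.Icc 2 M, x m ^ 2 :=
      mul_nonneg (mul_nonneg hc.le (Real.rpow_nonneg (Nat.cast_nonneg M) _)) hsq
    have := h M x
    simp only [neg_zero, zero_mul]
    linarith

/-- **Plain PSD of every rung is RH**: `(∀ M x, 0 ≤ x·S_M·x) ↔ RH` (the `c = 0` boundary of H2). -/
theorem rungsPSD_iff_rh :
    (∀ (M : ℕ) (x : ℕ → ℝ),
      0 ≤ ∑ m ∈ Finset.Icc 2 M, ∑ m' ∈ Finset.Icc 2 M,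
          zetaScrewKernel (Real.log m) (Real.log m') * (x m * x m')) ↔
    _root_.RiemannHypothesis := by
  constructor
  · intro h
    refine additiveSlack_iff_rh.1 ⟨0, fun M x => ?_⟩
    simpa using h M x
  · intro hRH M x
    obtain ⟨K, hK⟩ := additiveSlack_iff_rh.2 hRH
    -- use the floor directly (K from the ← direction is 0, but we do not rely on that)
    obtain ⟨A, c, hc, h⟩ := floorOfRH_proof hRH
    have hsq : 0 ≤ ∑ m ∈ Finset.Icc 2 M, x m ^ 2 := Finset.sum_nonneg fun m _ => sq_nonneg _
    have h0 : 0 ≤ c * (M : ℝ) ^ (-A) * ∑ m ∈ Finset.Icc 2 M, x m ^ 2 :=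
      mul_nonneg (mul_nonneg hc.le (Real.rpow_nonneg (Nat.cast_nonneg M) _)) hsq
    exact le_trans h0 (h M x)

/-- **Level-wise positive definiteness (quantifiers swapped, no uniformity) is RH**:
`(∀ M ≥ 2, ∃ c_M > 0, ∀ x, c_M·Σx² ≤ x·S_M·x) ↔ RH`.  So the crux's uniform polynomial law adds
nothing to, and removes nothing from, its RH-strength: the `∃ (A,c) ∀ M` order is not the issue. -/
theorem levelwisePD_iff_rh :
    (∀ M : ℕ, 2 ≤ M → ∃ c : ℝ, 0 < c ∧ ∀ x : ℕ → ℝ,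
      c * ∑ m ∈ Finset.Icc 2 M, x m ^ 2 ≤
        ∑ m ∈ Finset.Icc 2 M, ∑ m' ∈ Finset.Icc 2 M,
          zetaScrewKernel (Real.log m) (Real.log m') * (x m * x m')) ↔
    _root_.RiemannHypothesis := by
  constructor
  · intro h
    refine rungsPSD_iff_rh.1 fun M x => ?_
    rcases Nat.lt_or_ge M 2 with hM | hM
    · have hE : Finset.Icc 2 M = ∅ := Finset.Icc_eq_empty (by omega)
      simp [hE]
    · obtain ⟨c, hc, hcx⟩ := h M hM
      have hsq : 0 ≤ ∑ m ∈ Finset.Icc 2 M, x m ^ 2 := Finset.sum_nonneg fun m _ => sq_nonneg _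
      exact le_trans (mul_nonneg hc.le hsq) (hcx x)
  · intro hRH M hM
    obtain ⟨A, c, hc, h⟩ := floorOfRH_proof hRH
    have hMpos : (0 : ℝ) < M := by exact_mod_cast (by omega : 0 < M)
    exact ⟨c * (M : ℝ) ^ (-A), mul_pos hc (Real.rpow_pos_of_pos hMpos _), fun x => h M x⟩

/-! ## §2 Tightness at the bottom level -/

/-- **The constant is pinned at `M = 2`**: any floor pair has `c·2^{-A} ≤ 2Ψ(log 2)` (test the
indicator of `2`; numerically `2Ψ(log 2) ≈ 0.127`, so at `A = 1`, `c ≤ 4Ψ(log 2) ≈ 0.254`, while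
`λ_min(S_M)·M → 0.2519`). -/
theorem floor_constant_at_two {A c : ℝ}
    (h : ∀ (M : ℕ) (x : ℕ → ℝ),
      c * (M : ℝ) ^ (-A) * ∑ m ∈ Finset.Icc 2 M, x m ^ 2 ≤
        ∑ m ∈ Finset.Icc 2 M, ∑ m' ∈ Finset.Icc 2 M,
          zetaScrewKernel (Real.log m) (Real.log m') * (x m * x m')) :
    c * (2 : ℝ) ^ (-A) ≤ 2 * zetaScrew (Real.log 2) := by
  classical
  have hmem : 2 ∈ Finset.Icc 2 2 := Finset.mem_Icc.mpr ⟨le_rfl, le_rfl⟩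
  have h1 := h 2 (fun k => if k = 2 then 1 else 0)
  rw [form_indicator hmem, sq_indicator hmem, mul_one] at h1
  exact_mod_cast h1

/-- More generally the diagonal pins `c·m^{-A} ≤ 2Ψ(log m)` at every `m ≥ 2` (so record lows of
`Ψ∘log` on `ℕ` — `0.0275` at `m = 3100` — bound `c` at `A` fixed). -/
theorem floor_constant_at_level {A c : ℝ}
    (h : ∀ (M : ℕ) (x : ℕ → ℝ),
      c * (M : ℝ) ^ (-A) * ∑ m ∈ Finset.Icc 2 M, x m ^ 2 ≤
        ∑ m ∈ Finset.Icc 2 M, ∑ m' ∈ Finset.Icc 2 M,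
          zetaScrewKernel (Real.log m) (Real.log m') * (x m * x m'))
    (m : ℕ) (hm : 2 ≤ m) :
    c * (m : ℝ) ^ (-A) ≤ 2 * zetaScrew (Real.log m) := by
  classical
  have hmem : m ∈ Finset.Icc 2 m := Finset.mem_Icc.mpr ⟨hm, le_rfl⟩
  have h1 := h m (fun k => if k = m then 1 else 0)
  rw [form_indicator hmem, sq_indicator hmem, mul_one] at h1
  exact h1

/-! ## §4 Targets — none (no stuck stubs; `stub_targetPSD` = route target = RH) -/

/-- The only registered stub of the crux's skeleton is the route target, which is RH
(`IntegerScrew.integerScrewPSD_iff_riemannHypothesis`): killing it = disproving RH. -/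
theorem target_stub_iff_rh : IntegerScrewPSD ↔ _root_.RiemannHypothesis :=
  IntegerScrew.integerScrewPSD_iff_riemannHypothesis

/-! ## §5 Near-misses (sorry permitted in this workfile only) -/

/-- FORMER NEAR-MISS 1, now a THEOREM (rev 2): **the diagonal has no uniform positive floor**,
`¬ ∃ c > 0, ∀ m ≥ 2, c ≤ Ψ(log m)`, unconditionally.  LANDED:
`Cruxes.ScrewPolyFloor.Negative.zetaScrew_log_not_uniformly_positive` (p161936; RH branch by Dirichlet's
simultaneous approximation on the zero ordinates, `¬RH` branch by the Landau engine). -/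
theorem diag_not_uniformly_positive :
    ¬ (∃ c : ℝ, 0 < c ∧ ∀ m : ℕ, 2 ≤ m → c ≤ zetaScrew (Real.log m)) :=
  Summit.RiemannHypothesis.Cruxes.ScrewPolyFloor.Negative.zetaScrew_log_not_uniformly_positive

/-- Its quantitative form: **`liminf_{m→∞} Ψ(log m) ≤ 0` unconditionally** — arbitrarily late nodes
with arbitrarily small screw value (LANDED: `Negative.exists_zetaScrew_log_lt`).  With
`floor_constant_at_level` this says: at `A` fixed, the admissible constant `c` of a floor pair is
squeezed by the record lows of `Ψ∘log` along `ℕ` (`c ≤ 2 m^{A} Ψ(log m)` at every node). -/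
theorem diag_liminf_le_zero {ε : ℝ} (hε : 0 < ε) (m₀ : ℕ) :
    ∃ m : ℕ, m₀ ≤ m ∧ 2 ≤ m ∧ zetaScrew (Real.log m) < ε :=
  Summit.RiemannHypothesis.Cruxes.ScrewPolyFloor.Negative.exists_zetaScrew_log_lt hε m₀

/-- Read on the matrices: the diagonal entries of the `S_M` are not bounded away from `0`
(LANDED: `Negative.screwPolyFloor_diag_not_uniform`) — no Gershgorin / diagonal-dominance road. -/
theorem diag_entries_not_uniform :
    ¬ (∃ c : ℝ, 0 < c ∧ ∀ M : ℕ, ∀ m ∈ Finset.Icc 2 M,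
        c ≤ zetaScrewKernel (Real.log m) (Real.log m)) :=
  Summit.RiemannHypothesis.Cruxes.ScrewPolyFloor.Negative.screwPolyFloor_diag_not_uniform

/-- NEAR-MISS 2 (open, numerically true with `C ≈ 0.252`; see the rev-2 obstruction in the header): **log-free upper slack**
`λ_min(S_M) ≤ C/M`.  The tree's two-point vector gives only `Ψ(log(M/(M−1))) ~ (log M)/(2M)`; the
numerical bottom eigenvector is delocalised (coefficients of `ζ(s)Q(s)/√m`, `Q(1) ≈ 0`, kit j025404),
killing the small zeros by oscillation AND nearly saturating the von Mangoldt–Helson form.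
OBSTRUCTION: needs a two-sided evaluation of `x·S_M·x` for a structured length-`M` vector, i.e. the
prime side of the explicit formula with error `o(1/M)` — not attempted in Lean. -/
theorem logFree_upperSlack :
    ∃ C : ℝ, ∃ M₀ : ℕ, ∀ M : ℕ, M₀ ≤ M → ∃ x : ℕ → ℝ,
      0 < ∑ m ∈ Finset.Icc 2 M, x m ^ 2 ∧
        ∑ m ∈ Finset.Icc 2 M, ∑ m' ∈ Finset.Icc 2 M,
            zetaScrewKernel (Real.log m) (Real.log m') * (x m * x m') ≤
          C / M * ∑ m ∈ Finset.Icc 2 M, x m ^ 2 := by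
  sorry

end Summit.RiemannHypothesis.RiemannHypothesis.Cruxes.ScrewPolyFloor.Disproof

end
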